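import Literature.AlgebraicGeometry.HodgeTheory.WeilTypeCMFieldHodgeGroupUEOfLie
import Literature.AlgebraicGeometry.HodgeTheory.CMHodgeGroupBlockedDualBases
import Literature.RepresentationTheory.ClassicalInvariants.MixedTensorLieInvariantsSLBlockDiagonal
import HarnessLib

/-!
# The Lie-to-group passage for abelian varieties of Weil type whose endomorphism algebra is a commutative algebra `ℚ[φ_E] ⊋ K` with UNEQUAL multiplicities (products `Y × E_K`, `Y × Z`): «`Lie Hg(H¹A) ⊗ ℂ ⊇ 𝔰(⊕_k 𝔤𝔩(W_k))`» ⟹ «`Hg(A)(ℂ)|_{H¹} ⊇ S(A)(ℂ) ∩ {det_{W_K} = 1}`» (Deligne's rigidity + in-block unipotent generation + the diagonal torus; the socket «B5a-P» of TABLE X rows 17 ∕ 22)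

Family `hodge`, layer `Literature/AlgebraicGeometry/HodgeTheory`, namespace `Literature.AlgebraicGeometry.HodgeTheory`.
THEOREMS ONLY: no definition, no named fact, no `sorry` (D-0026). Cell `pub-hodgeav-hg6` (req-37 (A) Q2b), seat eng-2 g7,
brick **B5a-P** = R17-S part S3 (lead g4 2026-08-29T07:53:39Z GO; parts S1 = `ClassicalInvariants/MixedTensorLieInvariantsSLBlockDiagonal`,
S2 = `HodgeTheory/CMHodgeGroupBlockedDualBases`). HONEST FRAMING: HC ∕ HC_AV (stmt-1333) ∕ HC_CM (stmt-3052) ∕ H2 NOT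
proved; the Lie hypothesis `hSU` («every operator commuting with `φ_ℂ` (generator of `K`) and `φ_{E,ℂ}` (generator of
`End⁰(A)`), `ψ_ℂ`-skew and with trace `0` on `W_K = ker(φ_ℂ − i√d)` lies in `Lie Hg(H¹A) ⊗ ℂ`» — the shape of brick B5a-E's
hypothesis VERBATIM) is DISPLAYED on every theorem, never discharged here.

## The statement and its place

The census file of TABLE X rows 17 ∕ 19 ∕ 22 (`SixfoldTableXCensusWeilProductRowsGeneral`, L17) displays the GROUP-LEVEL
hypothesis `hG : ∀ u ∈ S(A)(h)(ℂ) = unitaryCentralizerGroup A h, det(u | W_K) = 1 → u ∈ Hg(A)(ℂ)|_{H¹}`. The tree's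
sockets deriving `hG` from a Lie statement are B5a (`WeilTypeSixfoldHodgeGroupSUOfLie`: `End⁰(A) = K`) and B5a-E
(`WeilTypeCMFieldHodgeGroupUEOfLie`: `End⁰(A) = E ⊋ K` with EQUAL multiplicities `n₀` of the eigenvalues of `φ_E` — a CM
type). For the PRODUCT rows `End⁰(A) = ℚ[φ_E]` is still commutative and singly generated (`K × K`, `K × F`), but the
eigenvalues of `φ_E` on `W_K` have UNEQUAL multiplicities (`(5,1)` on row 17, `(3,1,1,1)` on row 22), and the Hodge Lie
algebra on `W_K` is the BLOCK-DIAGONAL traceless algebra `𝔰(⊕_k 𝔤𝔩(W_k))`. This file is B5a with the alphabet of the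
`W_K`-letters BLOCKED by the eigenvalues of `φ_E` (letters from S2, invariant theory from S1):
* §1 **`AVSlots.exists_blockSlInvariant_coeff_of_hodgeLieC`** — under `hSU`, every rational `(p,p)`-class on a variety with
  slots over `A` has a coefficient function (in blocked adapted `ψ_ℂ`-dual letters) whose slices are killed by the typed
  differential of every BLOCK-DIAGONAL traceless `X` (the operator `X ⊕ −Xᵀ` commutes with `φ_{E,ℂ}` exactly because `X` is
  block-diagonal; the rest is B5a §1: it commutes with `φ_ℂ`, is `ψ_ℂ`-skew, has `tr|_{W_K} = tr X = 0`, so lies in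
  `Lie Hg ⊗ ℂ`, and Theorem L-Hg `wordDerAt_eq_zero_of_mem_hodgeLieC` kills the rational coefficient tensor).
* §2 **`IsWeilType.trans_mem_hodgeGroupOne_blocked_of_det_eq_one`** — every automorphism `v₀` of `H¹(A;ℚ) ⊗ ℂ` commuting
  with `φ_ℂ` AND `φ_{E,ℂ}`, preserving `ψ_ℂ`, with `det(v₀|W_K) = 1`, transported to `H¹(A(ℂ); ℂ)`, lies in `Hg(A)(ℂ)|_{H¹}`:
  its matrix `M` on the `W_K`-letters is block-diagonal (it commutes with `φ_{E,ℂ}`), so S1's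
  `wordRepAt_mixedGrpFamily_eq_self_of_forall_blockDiag_trace_of_det_eq_one` (in-block transvections + the determinant-one
  diagonal torus, Goodman–Wallach Thm. 2.2.2 ∕ 2.2.7 (2)) fixes the slices, `⋀•(v^{⊕(a+1)})` fixes the Hodge classes of every
  power (B5a §2 `diagPowExterior_wordEval_avLetters_eq_wordEval_colourChangeAt`) and `v ∈ Hg|_{H¹}`
  (`exteriorPullbackEquiv_mem_hodgeGroup_of_forall`; `v ∈ C(A)^×` by `End_Hdg = ℚ[φ_E^*]`,
  `mem_centralizerGroup_of_comm_pullbackOne_of_endAlg_eq_polynomial`).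
* §3 **`IsWeilType.mem_hodgeGroupOne_of_mem_unitaryCentralizerGroup_blocked_of_hodgeLieC`** — THE SOCKET: for
  `u ∈ S(A)(h)(ℂ)` with `det(u | W_K) = 1`, `u ∈ Hg(A)(ℂ)|_{H¹}` (B5a §4's `u = v` trick verbatim: `v = (M, (M⁻¹)ᵀ)` with
  `M` the block-diagonal matrix of `u|_{W_K}`; `W̄_K` is `Q_h`-isotropic as `φ^*` is a `d`-similitude of `Q_h`).
AV-level data (all dischargeable for `A ∼ Y₅ × E_K` from the product structure): `(A, φ)` of Weil type `(n, d)`; `φ_E ∈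
End(A)` with `finrank_ℚ End⁰(A) = 2|ι|`; colours `μ : ι → ℂ` (injective, no `μ k'` conjugate to a `μ k`) such that the
`2|ι|` eigenspaces `W_{μ k}`, `W_{μ̄ k}` of `φ_{E,ℂ}^*` are non-zero, span `H¹ ⊗ ℂ`, and form the `K`-fibre: `W_{μ k} ⊆ W_K`,
`W_{μ̄ k} ⊆ W̄_K`. NO equal-multiplicity hypothesis.

IN PRINT? Method: Deligne I §3, Goodman–Wallach Thm. 2.2.7 (2), Gordon §6; the statement as a socket for products of
Weil type is not in print (presearch of the R17-S design: null) — RECORD-class.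

## References
* [Deligne1982HodgeCycles] P. Deligne, LNM 900 (1982), I §3 Prop. 3.4, 3.6, §4 (p. 30).
* [MoonenZarhin1999LowDim] B. Moonen, Yu. Zarhin, Math. Ann. 315 (1999), §1 (1.8), §2 (2.3), §5 (5.11).
* [GoodmanWallachGTM255] R. Goodman, N. R. Wallach, GTM 255 (2009), Lemma 2.2.1, Thm. 2.2.2, Thm. 2.2.7 (2), §4.1.1.
* [Milne1999LefschetzClasses] J. S. Milne, Duke Math. J. 96 (1999), §1 pp. 643–644, §4 p. 659.
* [Gordon1997] B. B. Gordon, arXiv:alg-geom/9709030, §6 pp. 18–19.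
* [vanGeemen1994HodgeAV] B. van Geemen, LNM 1594 (1994), 6.9, Lemma 6.10.
-/

noncomputable section

open scoped TensorProduct
open scoped Matrix
open CategoryTheory Module

namespace Literature.AlgebraicGeometry.HodgeTheory

open Literature.AlgebraicTopology.SingularHomology
open Literature.AlgebraicGeometry.Motives (IsSmoothProjective AbelianVariety bettiCohomology
  ofRatClassBaseChange ofRatClassBaseChange_tmul HodgeTensorFacts hodgeTensorFacts_holds)
open Literature.AlgebraicGeometry.Motives.HodgeStructure
open Literature.RepresentationTheory.GeneralLinear
open Literature.RepresentationTheory.ClassicalInvariants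
open Literature.NumberTheory.DiophantineGeometry
open Literature.AlgebraicGeometry.VanGeemen1994 (pullbackOne hodgeGroupOne mem_hodgeGroupOne_iff hodgeClassSpan
  detOnEigenspace)
open Literature.AlgebraicGeometry.Milne1999
open Literature.AlgebraicGeometry.ComplexMultiplication (bettiRep bettiRep_of)

/-! ### §0 Small linear algebra -/

section LinearAlgebra

variable {K : Type*} [Field K] {V : Type*} [AddCommGroup V] [Module K V]

/-- The two elements of `Fin 2`. [folklore] -/
private theorem fin2_cases₆ (r : Fin 2) : r = 0 ∨ r = 1 := by
  fin_cases r <;> simp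

/-- Bilinear expansion on two finite combinations: `B(∑ aᵣ eᵣ, ∑ bₛ fₛ) = ∑ᵣ ∑ₛ aᵣ bₛ B(eᵣ, fₛ)`. [folklore] -/
private theorem bilin_apply_sum_smul_sum_smul₆ {W : Type*} [AddCommGroup W] [Module K W] {ι : Type*} [Fintype ι]
    (B : V →ₗ[K] V →ₗ[K] W) (a b : ι → K) (e f : ι → V) :
    B (∑ r, a r • e r) (∑ s, b s • f s) = ∑ r, ∑ s, (a r * b s) • B (e r) (f s) := by
  rw [LinearMap.map_sum₂]
  refine Finset.sum_congr rfl fun r _ => ?_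
  rw [LinearMap.map_smul₂, map_sum, Finset.smul_sum]
  refine Finset.sum_congr rfl fun s' _ => ?_
  rw [map_smul, smul_smul]

/-- **The matrix of an operator commuting with a diagonalised operator is block-diagonal for the eigenvalue blocks**: if
`f (e ℓ) = ε ℓ • e ℓ` on a basis-like independent family and `Y (e ℓ) = ∑_r X r ℓ • e r` with `Y ∘ f = f ∘ Y` on the
`e ℓ`, then `X r ℓ = 0` whenever `ε r ≠ ε ℓ`. [cite: GoodmanWallachGTM255, §4.1.1] -/
theorem matrix_entry_eq_zero_of_comm_of_eigen {k : ℕ} {e : Fin k → V} (he : LinearIndependent K e)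
    {f Y : Module.End K V} {ε : Fin k → K} (hf : ∀ ℓ, f (e ℓ) = ε ℓ • e ℓ) (X : Matrix (Fin k) (Fin k) K)
    (hY : ∀ ℓ, Y (e ℓ) = ∑ r, X r ℓ • e r) (hcomm : ∀ ℓ, Y (f (e ℓ)) = f (Y (e ℓ))) {r ℓ : Fin k}
    (hne : ε r ≠ ε ℓ) : X r ℓ = 0 := by
  have h := hcomm ℓ
  rw [hf, map_smul, hY, map_sum, Finset.smul_sum] at h
  simp only [map_smul, hf, smul_smul] at h
  have h0 : ∑ r', (ε ℓ * X r' ℓ - X r' ℓ * ε r') • e r' = 0 := by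
    simp only [sub_smul, Finset.sum_sub_distrib]
    rw [h, sub_self]
  have h1 := Fintype.linearIndependent_iff.1 he _ h0 r
  rcases mul_eq_zero.1 (show (ε ℓ - ε r) * X r ℓ = 0 by rw [sub_mul, ← h1]; ring) with h2 | h2
  · exact absurd (sub_eq_zero.1 h2).symm hne
  · exact h2

/-- The inverse of an invertible block-diagonal matrix is block-diagonal (it commutes with the diagonal matrix of an
injective block labelling). [cite: GoodmanWallachGTM255, §4.1.1] -/
theorem nonsing_inv_apply_eq_zero_of_blockDiag {k : ℕ} {ι : Type*} (blk : Fin k → ι) {μ : ι → K}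
    (hμ : Function.Injective μ) {M : Matrix (Fin k) (Fin k) K} (hM : ∀ a b, blk a ≠ blk b → M a b = 0)
    (hdet : IsUnit M.det) {a b : Fin k} (hab : blk a ≠ blk b) : M⁻¹ a b = 0 := by
  classical
  set D : Matrix (Fin k) (Fin k) K := Matrix.diagonal (μ ∘ blk) with hD
  have hMD : M * D = D * M := by
    ext i j
    rw [hD, Matrix.mul_diagonal, Matrix.diagonal_mul, Function.comp_apply, Function.comp_apply]
    by_cases h : blk i = blk j
    · rw [h, mul_comm]
    · rw [hM i j h, mul_zero, zero_mul]
  have hinv : M⁻¹ * D = D * M⁻¹ := by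
    calc M⁻¹ * D = M⁻¹ * D * (M * M⁻¹) := by rw [Matrix.mul_nonsing_inv M hdet, mul_one]
      _ = M⁻¹ * (D * M) * M⁻¹ := by simp only [mul_assoc]
      _ = M⁻¹ * (M * D) * M⁻¹ := by rw [← hMD]
      _ = (M⁻¹ * M) * D * M⁻¹ := by simp only [mul_assoc]
      _ = D * M⁻¹ := by rw [Matrix.nonsing_inv_mul M hdet, one_mul]
  have h := congr_fun (congr_fun hinv a) b
  rw [hD, Matrix.mul_diagonal, Matrix.diagonal_mul, Function.comp_apply, Function.comp_apply] at h
  rcases mul_eq_zero.1 (show M⁻¹ a b * (μ (blk b) - μ (blk a)) = 0 by rw [mul_sub, h]; ring) with h1 | h1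
  · exact h1
  · exact absurd (sub_eq_zero.1 h1) (fun h2 => hab (hμ h2).symm)

end LinearAlgebra

/-! ### §1 INVARIANCE: under «`Lie Hg ⊗ ℂ ⊇ 𝔰(⊕_k 𝔤𝔩(W_k))`» the Hodge classes on varieties with slots over `A` are killed by the block-diagonal traceless typed differentials -/

section Invariance

variable {A B : AbelianVariety ℂ} {n : ℕ} {g : Fin n → (B ⟶ A)}

open scoped Classical in
/-- **THE INVARIANCE THEOREM under the displayed Lie hypothesis `hSU` (blocked form).** Data: `A` a complex abelian
variety, `ψ` a polarization of `H¹(A(ℂ); ℚ)`, `φ` (generator of `E = End⁰`) and `φK` (generator of `K`) rational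
endomorphisms, `hSU`: every operator commuting with `φK_ℂ` and with `φ_ℂ`, `ψ_ℂ`-skew and with trace `0` on
`W_K = ker(φK_ℂ − μK)` lies in `Lie Hg ⊗ ℂ`; BLOCKED adapted `ψ_ℂ`-dual letters `cb (t, ℓ)` (S2
`CMTheta.exists_blockedAdaptedDualBasis`): type-`0` letters in `W_K` and in `W_{μ (blk ℓ)}(φ)`, type-`1` letters in
`ker(φK_ℂ − μK')`, `μK' ≠ μK`, and in `W_{conj μ (blk ℓ)}(φ)`, kinds `κ`, pairing table `δ`, same-type pairings `0`; and
`B` with slots `g` over `A`. Then every rational `(p,p)`-class on `B` (`p ≥ 1`) is `∑_w a(w)·(g cb)_w` for a coefficient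
function `a` on slot-and-type words such that for every such word `U` and every BLOCK-DIAGONAL (`X i j = 0` if
`blk i ≠ blk j`) TRACELESS `X` the typed differential (`X` at the type-`0` positions, `−Xᵀ` at the type-`1` positions)
kills the slice `a(U, −)`: the operator `Y = X ⊕ −Xᵀ` commutes with `φK_ℂ` (blockwise scalars), commutes with `φ_ℂ`
BECAUSE `X` is block-diagonal, is `ψ_ℂ`-skew (the pairing table) and has `tr(Y|W_K) = tr X = 0`, so `hSU` puts it in
`Lie Hg ⊗ ℂ` and Theorem L-Hg (`wordDerAt_eq_zero_of_mem_hodgeLieC`, Deligne's rigidity) kills the rational coefficient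
tensor. The letter transport is that of the tree's B5a `AVSlots.exists_slInvariant_coeff_of_hodgeLieC` (credited).
[cite: Deligne1982HodgeCycles, I §3 Prop. 3.4 and §4 (p. 30)] [cite: MoonenZarhin1999LowDim, §1 (1.8), §2 (2.3) and §3 (3.1)]
[cite: Gordon1997, §6 (pp. 18–19)] -/
theorem AVSlots.exists_blockSlInvariant_coeff_of_hodgeLieC [HodgeTensorFacts.{0, 0}] (hg : AVSlots A B g)
    (hHD : exists_isReal_hodgeModel) (hI : hodgePQ_independent_of_hodgeModel)
    (ψ : (BettiUniverse.hodge hHD (AbelianVariety.isSmoothProjective_holds (A := A)) 1).Polarization)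
    {φ φK : Module.End ℚ (bettiCohomology A.X 1)} {μK μK' : ℂ} (hμK : μK' ≠ μK)
    (hSU : ∀ (Y : Module.End ℂ (ℂ ⊗[ℚ] bettiCohomology A.X 1)) (hYφ : Y * φK.baseChange ℂ = φK.baseChange ℂ * Y),
      Y * φ.baseChange ℂ = φ.baseChange ℂ * Y →
      (∀ x y, ψ.form.baseChange ℂ (Y x) y + ψ.form.baseChange ℂ x (Y y) = 0) →
      LinearMap.trace ℂ _ (Y.restrict fun x (hx : x ∈ Module.End.eigenspace (φK.baseChange ℂ) μK) =>
        UnitaryTheta.apply_mem_eigenspace_of_commute hYφ hx) = 0 →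
      Y ∈ (BettiUniverse.hodge hHD (AbelianVariety.isSmoothProjective_holds (A := A)) 1).hodgeLieC)
    {ι : Type} (μ : ι → ℂ) {n₀ : ℕ} (cb : Module.Basis (Fin 2 × Fin n₀) ℂ (ℂ ⊗[ℚ] bettiCohomology A.X 1))
    (κ : Fin n₀ → Fin 2) (blk : Fin n₀ → ι)
    (hcbE : ∀ ℓ, cb (0, ℓ) ∈ Module.End.eigenspace (φ.baseChange ℂ) (μ (blk ℓ)))
    (hcbE' : ∀ ℓ, cb (1, ℓ) ∈ Module.End.eigenspace (φ.baseChange ℂ) (starRingEnd ℂ (μ (blk ℓ))))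
    (hKcb : ∀ ℓ, cb (0, ℓ) ∈ Module.End.eigenspace (φK.baseChange ℂ) μK)
    (hKcb' : ∀ ℓ, cb (1, ℓ) ∈ Module.End.eigenspace (φK.baseChange ℂ) μK')
    (hcb0 : ∀ ℓ, κ ℓ = 0 →
      cb (0, ℓ) ∈ (BettiUniverse.hodge hHD (AbelianVariety.isSmoothProjective_holds (A := A)) 1).piece 1 0 ∧
      cb (1, ℓ) ∈ (BettiUniverse.hodge hHD (AbelianVariety.isSmoothProjective_holds (A := A)) 1).piece 0 1)
    (hcb1 : ∀ ℓ, κ ℓ = 1 →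
      cb (0, ℓ) ∈ (BettiUniverse.hodge hHD (AbelianVariety.isSmoothProjective_holds (A := A)) 1).piece 0 1 ∧
      cb (1, ℓ) ∈ (BettiUniverse.hodge hHD (AbelianVariety.isSmoothProjective_holds (A := A)) 1).piece 1 0)
    (hdual : ∀ i j, ψ.form.baseChange ℂ (cb (0, i)) (cb (1, j)) = if i = j then 1 else 0)
    (hiso : ∀ (t : Fin 2) i j, ψ.form.baseChange ℂ (cb (t, i)) (cb (t, j)) = 0)
    {p : ℕ} (hp : 0 < p) {c : complexBetti B.X (2 * p)} (hcQ : IsRationalClass c)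
    (hc : IsOfHodgeType B.dim B.X (2 * p) p p c) :
    ∃ a : (Fin (2 * p) → (Fin n × Fin 2) × Fin n₀) → ℂ,
      wordEval (cupPowOneAlt ℂ (Motives.ComplexPoints B.X) (2 * p))
        (fun x : (Fin n × Fin 2) × Fin n₀ => avLetters g (fun tl : Fin 2 × Fin n₀ =>
          ofRatClassBaseChange (Motives.ComplexPoints A.X) 1 (cb tl)) (x.1.1, (x.1.2, x.2))) a = c ∧
      ∀ (U : Fin (2 * p) → Fin n × Fin 2) (X : Matrix (Fin n₀) (Fin n₀) ℂ), (∀ i j, blk i ≠ blk j → X i j = 0) →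
        X.trace = 0 → wordDerAt ℂ (fun t => if (U t).2 = 0 then X else -Xᵀ) (wordSlice a U) = 0 := by
  classical
  -- (the letter transport below is that of B5a `AVSlots.exists_slInvariant_coeff_of_hodgeLieC`)
  -- the setting
  have hX : IsSmoothProjective A.dim A.X := AbelianVariety.isSmoothProjective_holds
  haveI : Module.Finite ℚ (bettiCohomology A.X 1) := finite_bettiCohomology_one A
  have hn1 : (((1 : ℕ) : ℤ)) = 1 := Nat.cast_one
  have heff := BettiUniverse.hodge_isEffective hHD hX 1
  set F := cupPowOneAlt ℂ (Motives.ComplexPoints B.X) (2 * p) with hFdef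
  have hFinj : Function.Injective (exteriorPower.alternatingMapLinearEquiv F) :=
    injective_alternatingMapLinearEquiv_cupPowOneAlt B (2 * p)
  -- bases: the adapted basis `cbσ` and the rational basis `eC`, both indexed by `Fin M`
  set eQ := Module.finBasis ℚ (bettiCohomology A.X 1) with heQ
  set eC : Module.Basis (Fin (Module.finrank ℚ (bettiCohomology A.X 1))) ℂ
    (ℂ ⊗[ℚ] bettiCohomology A.X 1) := Algebra.TensorProduct.basis ℂ eQ with heC
  set φι : Fin (Module.finrank ℚ (bettiCohomology A.X 1)) ≃ Fin 2 × Fin n₀ := eC.indexEquiv cb with hφι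
  set cbσ : Module.Basis (Fin (Module.finrank ℚ (bettiCohomology A.X 1))) ℂ
    (ℂ ⊗[ℚ] bettiCohomology A.X 1) := cb.reindex φι.symm with hcbσdef
  have hcbσ : ∀ m, cbσ m = cb (φι m) := fun m => by
    rw [hcbσdef, Module.Basis.reindex_apply, Equiv.symm_symm]
  -- kinds of the adapted letters
  set κ2 : Fin 2 × Fin n₀ → Fin 2 := fun tl => if tl.1 = 0 then κ tl.2 else (if κ tl.2 = 0 then 1 else 0)
    with hκ2
  have hkind : ∀ tl : Fin 2 × Fin n₀,
      (κ2 tl = 0 → cb tl ∈ (BettiUniverse.hodge hHD (AbelianVariety.isSmoothProjective_holds (A := A)) 1).piece 1 0) ∧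
      (κ2 tl = 1 → cb tl ∈ (BettiUniverse.hodge hHD (AbelianVariety.isSmoothProjective_holds (A := A)) 1).piece 0 1) := by
    rintro ⟨t, ℓ⟩
    rcases fin2_cases₆ t with rfl | rfl <;> rcases fin2_cases₆ (κ ℓ) with h | h
    · have hk : κ2 (0, ℓ) = 0 := by simp [hκ2, h]
      rw [hk]
      exact ⟨fun _ => (hcb0 ℓ h).1, fun h' => absurd h' (by decide)⟩
    · have hk : κ2 (0, ℓ) = 1 := by simp [hκ2, h]
      rw [hk]
      exact ⟨fun h' => absurd h' (by decide), fun _ => (hcb1 ℓ h).1⟩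
    · have hk : κ2 (1, ℓ) = 1 := by simp [hκ2, h]
      rw [hk]
      exact ⟨fun h' => absurd h' (by decide), fun _ => (hcb0 ℓ h).2⟩
    · have hk : κ2 (1, ℓ) = 0 := by simp [hκ2, h]
      rw [hk]
      exact ⟨fun _ => (hcb1 ℓ h).2, fun h' => absurd h' (by decide)⟩
  set κ' : Fin (Module.finrank ℚ (bettiCohomology A.X 1)) → Fin 2 := fun m => κ2 (φι m) with hκ'
  -- letters
  set ρ := ofRatClassBaseChangeEquiv hX 1 with hρ
  set v : Module.Basis _ ℂ (complexBetti A.X 1) := cbσ.map ρ with hv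
  set eL : Module.Basis _ ℂ (complexBetti A.X 1) := eC.map ρ with heL
  have heLQ : ∀ i, IsRationalClass (eL i) := fun i => by
    rw [heL, Module.Basis.map_apply, heC, Algebra.TensorProduct.basis_apply, hρ,
      ofRatClassBaseChangeEquiv_apply, ofRatClassBaseChange_tmul, one_smul]
    exact isRationalClass_ofRatClass _
  have hv_apply : ∀ m, v m = ofRatClassBaseChange (Motives.ComplexPoints A.X) 1 (cb (φι m)) := fun m => by
    rw [hv, Module.Basis.map_apply, hcbσ, hρ, ofRatClassBaseChangeEquiv_apply]
  have hv0 : ∀ m, κ' m = 0 → IsOfHodgeType A.dim A.X 1 1 0 (v m) := by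
    intro m hm
    rw [hv_apply, ← BettiUniverse.mem_hodge_piece_iff hHD hI hX (k := 1) (p := 1) (q := 0) rfl]
    exact (hkind (φι m)).1 hm
  have hv1 : ∀ m, κ' m = 1 → IsOfHodgeType A.dim A.X 1 0 1 (v m) := by
    intro m hm
    rw [hv_apply, ← BettiUniverse.mem_hodge_piece_iff hHD hI hX (k := 1) (p := 0) (q := 1) rfl]
    exact (hkind (φι m)).2 hm
  -- (α) an antisymmetric kind-balanced coefficient function in the adapted letters
  obtain ⟨ax, hax_bal, hax_anti, hcax⟩ := hg.exists_antisymm_kindBalanced_wordEval_eq v κ' hv0 hv1 hp hc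
  -- the change of letters to the rational letters
  set G : Matrix _ _ ℂ := eC.toMatrix cbσ with hG
  set G' : Matrix _ _ ℂ := cbσ.toMatrix eC with hG'
  have hG'G : G' * G = 1 := cbσ.toMatrix_mul_toMatrix_flip eC
  have hve : ∀ m, v m = ∑ i, G i m • eL i := fun m => by
    simp only [hv, heL, Module.Basis.map_apply, ← map_smul, ← map_sum]
    congr 1
    exact (eC.sum_toMatrix_smul_self (v := ⇑cbσ) (j := m)).symm
  have hletters : ∀ j m, avLetters g v (j, m) = ∑ i, G i m • avLetters g eL (j, i) :=
    avLetters_baseChange g G hve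
  set aE := colourChangeAt (fun _ : Fin n => G) ax with haE
  have haE_anti : IsAntisymm aE := hax_anti.colourChangeAt _
  have hcaE : wordEval F (avLetters g eL) aE = c := by
    rw [haE, ← wordEval_eq_wordEval_colourChangeAt F (fun _ : Fin n => G) hletters ax, hcax]
  -- rationality of `aE`
  obtain ⟨q, hq⟩ := hg.exists_rat_wordEval_eq eL heLQ hcQ
  obtain ⟨q', -, haEq⟩ := haE_anti.exists_eq_algebraMap_of_wordEval_eq hFinj (hg.letterBasis eL)
    (q := q) (by rw [AVSlots.coe_letterBasis, hcaE, hFdef, hq])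
  have hslice_e : ∀ u, wordSlice aE u = wordRepAt ℂ (fun _ : Fin (2 * p) => G) (wordSlice ax u) :=
    fun u => wordSlice_colourChangeAt (fun _ : Fin n => G) ax u
  -- the Hodge operator `Θ`: `diag(±1)` in the adapted letters
  obtain ⟨Θ, hΘ⟩ := exists_hodgeTheta (BettiUniverse.hodge hHD (AbelianVariety.isSmoothProjective_holds (A := A)) 1)
  obtain ⟨-, -, hΘ10, hΘ01, -⟩ :=
    UnitaryTheta.theta_facts (BettiUniverse.hodge hHD (AbelianVariety.isSmoothProjective_holds (A := A)) 1) hn1 heff hΘ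
  have hΘb : ∀ m, Θ (cbσ m) = (if κ' m = 0 then (1 : ℂ) else -1) • cbσ m := by
    intro m
    rw [hcbσ]
    rcases fin2_cases₆ (κ' m) with h0 | h1'
    · rw [h0, if_pos rfl, one_smul]
      exact hΘ10 _ ((hkind (φι m)).1 h0)
    · rw [h1', if_neg one_ne_zero, neg_one_smul]
      exact hΘ01 _ ((hkind (φι m)).2 h1')
  have hΘcb : LinearMap.toMatrix cbσ cbσ Θ = kindDiag κ' := by
    ext i m
    rw [LinearMap.toMatrix_apply, hΘb, map_smul, Module.Basis.repr_self, Finsupp.smul_apply,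
      Finsupp.single_apply, kindDiag, Matrix.diagonal_apply, smul_eq_mul, mul_ite, mul_one, mul_zero]
    by_cases him : i = m
    · subst him; rw [if_pos rfl]
    · rw [if_neg (Ne.symm him), if_neg him]
  have hJG : LinearMap.toMatrix eC eC Θ * G = G * kindDiag κ' := by
    rw [← hΘcb, hG, linearMap_toMatrix_mul_basis_toMatrix, basis_toMatrix_mul_linearMap_toMatrix]
  have hΘq : ∀ u : Fin (2 * p) → Fin n, wordDerAt ℂ (fun _ : Fin (2 * p) => LinearMap.toMatrix eC eC Θ)
      (wordSlice (fun w => algebraMap ℚ ℂ (q' w)) u) = 0 := by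
    intro u
    rw [← haEq, hslice_e]
    refine wordDerAt_wordRepAt_eq_zero_of_mul_eq ℂ (fun _ : Fin (2 * p) => G) (fun _ => hJG) ?_
    rw [wordDerAt_const]
    exact wordDer_kindDiag_wordSlice_eq_zero κ' hax_bal u
  -- structure of the adapted basis for `ψ_ℂ`, `φK_ℂ` and `φ_ℂ`
  set ψC := ψ.form.baseChange ℂ with hψC
  have hiso0 : ∀ i j, ψC (cb (0, i)) (cb (0, j)) = 0 := fun i j => hiso 0 i j
  have hiso1 : ∀ i j, ψC (cb (1, i)) (cb (1, j)) = 0 := fun i j => hiso 1 i j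
  have hswap10 : ∀ i j, ψC (cb (1, i)) (cb (0, j)) = -(if j = i then 1 else 0) := fun i j => by
    rw [hψC, ψ.form_baseChange_swap, show (((1 : ℕ) : ℤ)).negOnePow = -1 from Int.negOnePow_one, ← hψC, hdual]
    split_ifs <;> simp
  have hφKcb : ∀ t ℓ, φK.baseChange ℂ (cb (t, ℓ)) = (if t = 0 then μK else μK') • cb (t, ℓ) := by
    intro t ℓ
    rcases fin2_cases₆ t with rfl | rfl
    · rw [if_pos rfl]; exact Module.End.mem_eigenspace_iff.1 (hKcb ℓ)
    · rw [if_neg one_ne_zero]; exact Module.End.mem_eigenspace_iff.1 (hKcb' ℓ)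
  have hφEcb : ∀ t ℓ, φ.baseChange ℂ (cb (t, ℓ)) =
      (if t = 0 then μ (blk ℓ) else starRingEnd ℂ (μ (blk ℓ))) • cb (t, ℓ) := by
    intro t ℓ
    rcases fin2_cases₆ t with rfl | rfl
    · rw [if_pos rfl]; exact Module.End.mem_eigenspace_iff.1 (hcbE ℓ)
    · rw [if_neg one_ne_zero]; exact Module.End.mem_eigenspace_iff.1 (hcbE' ℓ)
  -- a basis of `W_K = ker(φK_ℂ − μK)` made of the letters `cb (0, ℓ)` (for the trace condition of `hSU`)
  obtain ⟨bW, hbW⟩ := exists_basis_eigenspace_of_block cb (f := φK.baseChange ℂ)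
    (ε := fun t => if t = 0 then μK else μK') hφKcb 0 (if_pos rfl) (fun t' ht' => by
      rcases fin2_cases₆ t' with rfl | rfl
      · exact absurd rfl ht'
      · rw [if_neg one_ne_zero]; exact hμK)
  -- the invariance of every slice under the BLOCK-DIAGONAL TRACELESS typed differentials, via `hSU` and THEOREM L-Hg
  have key : ∀ (X : Matrix (Fin n₀) (Fin n₀) ℂ), (∀ i j, blk i ≠ blk j → X i j = 0) → X.trace = 0 →
      ∀ (u : Fin (2 * p) → Fin n),
      wordDerAt ℂ (fun _ : Fin (2 * p) => blockLiftGen φι (fun t : Fin 2 => if t = 0 then X else -Xᵀ))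
        (wordSlice ax u) = 0 := by
    intro X hXb hXtr u
    set Nf : Fin 2 → Matrix (Fin n₀) (Fin n₀) ℂ := fun t => if t = 0 then X else -Xᵀ with hNf
    have hNf0 : Nf 0 = X := if_pos rfl
    have hNf1 : Nf 1 = -Xᵀ := if_neg one_ne_zero
    have hNfb : ∀ t r ℓ, blk r ≠ blk ℓ → Nf t r ℓ = 0 := by
      intro t r ℓ hb
      rcases fin2_cases₆ t with rfl | rfl
      · rw [hNf0]; exact hXb r ℓ hb
      · rw [hNf1, Matrix.neg_apply, Matrix.transpose_apply, hXb ℓ r (Ne.symm hb), neg_zero]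
    set Y := Matrix.toLin cbσ cbσ (blockLiftGen φι Nf) with hYdef
    have hYcb : ∀ t ℓ, Y (cb (t, ℓ)) = ∑ r, Nf t r ℓ • cb (t, r) :=
      fun t ℓ => toLin_blockLiftGen_apply φι cbσ (⇑cb) hcbσ Nf t ℓ
    have hYφ : Y * φK.baseChange ℂ = φK.baseChange ℂ * Y := by
      refine cb.ext fun tl => ?_
      obtain ⟨t, ℓ⟩ := tl
      rw [Module.End.mul_apply, Module.End.mul_apply, hφKcb, map_smul, hYcb, map_sum, Finset.smul_sum]
      exact Finset.sum_congr rfl fun r _ => by rw [map_smul, hφKcb, smul_comm]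
    -- `Y` commutes with `φ_ℂ` BECAUSE `X` is block-diagonal
    have hYφE : Y * φ.baseChange ℂ = φ.baseChange ℂ * Y := by
      refine cb.ext fun tl => ?_
      obtain ⟨t, ℓ⟩ := tl
      rw [Module.End.mul_apply, Module.End.mul_apply, hφEcb, map_smul, hYcb, map_sum, Finset.smul_sum]
      refine Finset.sum_congr rfl fun r _ => ?_
      rw [map_smul, hφEcb]
      by_cases hb : blk r = blk ℓ
      · rw [hb, smul_comm]
      · rw [hNfb t r ℓ hb, zero_smul, zero_smul, smul_zero]
    have hYskew : ∀ x y, ψC (Y x) y + ψC x (Y y) = 0 := by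
      have hB : ψC ∘ₗ Y + ψC.compl₂ Y = 0 := by
        refine LinearMap.BilinForm.ext_basis cb fun tk tl => ?_
        obtain ⟨t, k⟩ := tk
        obtain ⟨t', ℓ⟩ := tl
        rw [LinearMap.add_apply, LinearMap.add_apply, LinearMap.comp_apply, LinearMap.compl₂_apply,
          LinearMap.zero_apply, LinearMap.zero_apply, hYcb, hYcb, map_sum, LinearMap.sum_apply, map_sum]
        simp only [map_smul, LinearMap.smul_apply, smul_eq_mul]
        rcases fin2_cases₆ t with rfl | rfl <;> rcases fin2_cases₆ t' with rfl | rfl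
        · simp [hiso0]
        · simp [hNf0, hNf1, hdual, Matrix.neg_apply, Matrix.transpose_apply, mul_ite, Finset.sum_ite_eq,
            Finset.sum_ite_eq']
        · simp [hNf0, hNf1, hswap10, Matrix.neg_apply, Matrix.transpose_apply, mul_ite, Finset.sum_ite_eq,
            Finset.sum_ite_eq']
        · simp [hiso1]
      intro x y
      have h := LinearMap.congr_fun (LinearMap.congr_fun hB x) y
      simpa only [LinearMap.add_apply, LinearMap.comp_apply, LinearMap.compl₂_apply, LinearMap.zero_apply]
        using h
    -- the trace of `Y` on `W_K` is `tr X = 0`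
    have hYtr : LinearMap.trace ℂ _ (Y.restrict fun x (hx : x ∈ Module.End.eigenspace (φK.baseChange ℂ) μK) =>
        UnitaryTheta.apply_mem_eigenspace_of_commute hYφ hx) = 0 := by
      rw [trace_restrict_eq_of_apply_eq_sum bW hbW _ X (fun ℓ => by rw [hYcb, hNf0]), hXtr]
    have hYC := hSU Y hYφ hYφE hYskew hYtr
    have hL := wordDerAt_eq_zero_of_mem_hodgeLieC
      (BettiUniverse.hodge hHD (AbelianVariety.isSmoothProjective_holds (A := A)) 1) ψ eQ q' hΘ hΘq hYC u
    rw [← haEq, hslice_e] at hL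
    have hYG : ∀ _t : Fin (2 * p), LinearMap.toMatrix eC eC Y * G = G * LinearMap.toMatrix cbσ cbσ Y :=
      fun _ => by rw [hG, linearMap_toMatrix_mul_basis_toMatrix, basis_toMatrix_mul_linearMap_toMatrix]
    have hblk : LinearMap.toMatrix cbσ cbσ Y = blockLiftGen φι Nf := by
      rw [hYdef, LinearMap.toMatrix_toLin]
    have h3 : wordRepAt ℂ (fun _ : Fin (2 * p) => G)
        (wordDerAt ℂ (fun _ : Fin (2 * p) => blockLiftGen φι Nf) (wordSlice ax u)) = 0 := by
      rw [← hblk, wordRepAt_wordDerAt_of_mul_eq ℂ (fun _ : Fin (2 * p) => G) hYG, hL]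
    exact wordRepAt_injective ℂ (g := fun _ : Fin (2 * p) => G) (g' := fun _ : Fin (2 * p) => G')
      (funext fun _ => hG'G) (by rw [h3, map_zero])
  -- the coefficient function, refined to slot-and-type colours
  refine ⟨placeRefineGen φι ax, ?_, fun U X hXb hXtr => ?_⟩
  · rw [← hcax]
    have hx : (fun x : (Fin n × Fin 2) × Fin n₀ => avLetters g v (x.1.1, φι.symm (x.1.2, x.2))) =
        fun x => avLetters g (fun tl : Fin 2 × Fin n₀ =>
          ofRatClassBaseChange (Motives.ComplexPoints A.X) 1 (cb tl)) (x.1.1, (x.1.2, x.2)) := by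
      funext x
      rw [avLetters_apply, avLetters_apply, hv_apply, Equiv.apply_symm_apply]
    rw [← hx]
    exact wordEval_placeRefineGen F φι (avLetters g v) ax
  · exact wordDerAt_placeRefineGen_eq_zero φι (fun t : Fin 2 => if t = 0 then X else -Xᵀ) (key X hXb hXtr) U

end Invariance

/-! ### §2 `S(⊕_k GL(W_k))`-elements commuting with `φ_E`: from the Lie statement to the group element, on the Tannaka-free carrier -/

section BlockedLeHg

variable {A : AbelianVariety ℂ} {φ : A ⟶ A} {n d : ℕ} {ι : Type} [Fintype ι] [DecidableEq ι]

open scoped Classical in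
/-- **`S(A)(ℂ)-shaped elements are in `Hg` FROM THE LIE STATEMENT** (Weil type with `End⁰ = ℚ[φ_E] ⊋ K`, ANY
multiplicities). Let `(A, φ)` be of Weil type `(n, d)`, `φ_E ∈ End(A)` with `finrank_ℚ End⁰(A) = 2|ι|`, colours
`μ : ι → ℂ` (injective, no `μ k'` conjugate to a `μ k`) with the eigenspaces `W_{μ k}`, `W_{μ̄ k}` of `φ_{E,ℂ}^*` non-zero,
spanning `H¹ ⊗ ℂ`, and forming the `K`-fibre (`W_{μ k} ⊆ W_K = ker(φ_ℂ − i√d)`, `W_{μ̄ k} ⊆ W̄_K`); `ψ` a polarization of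
`H¹(A(ℂ); ℚ)` with the displayed Lie hypothesis `hSU`. Then every automorphism `v₀` of `H¹(A(ℂ); ℚ) ⊗ ℂ` commuting with
`φ_ℂ` and `φ_{E,ℂ}`, preserving `ψ_ℂ` and with `det(v₀ | W_K) = 1`, transported to `H¹(A(ℂ); ℂ)`, lies in
`Hg(A)(ℂ)|_{H¹} = hodgeGroupOne (dim A) A.X`: in blocked adapted `ψ_ℂ`-dual letters (S2) `v₀ = (M, (M⁻¹)ᵀ)` with `M`
BLOCK-DIAGONAL (`v₀` commutes with `φ_{E,ℂ}`) and `det M = 1`; the slices of the coefficient functions of the rational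
`(p,p)`-classes of every power are killed by the block-diagonal traceless typed differentials (§1), hence FIXED by the
typed family of `M` (S1 `wordRepAt_mixedGrpFamily_eq_self_of_forall_blockDiag_trace_of_det_eq_one`), so `⋀•(v^{⊕(a+1)})`
fixes those classes (B5a §2) and `v ∈ Hg(A)(ℂ)|_{H¹}`. [cite: Deligne1982HodgeCycles, I §3 Prop. 3.4 and 3.6]
[cite: GoodmanWallachGTM255, Thm. 2.2.2 and Thm. 2.2.7 (2)] [cite: MoonenZarhin1999LowDim, §5 (5.11)] -/
theorem IsWeilType.trans_mem_hodgeGroupOne_blocked_of_det_eq_one [HodgeTensorFacts.{0, 0}]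
    (hW : IsWeilType A φ n d) (φE : A ⟶ A) (hEcard : Module.finrank ℚ A.endAlgebra = 2 * Fintype.card ι)
    (μ : ι → ℂ) (hinj : Function.Injective μ) (hdist : ∀ k k', μ k' ≠ starRingEnd ℂ (μ k))
    (hWne : ∀ kt : ι × Fin 2, Module.End.eigenspace (((bettiCohomology.map φE.hom.hom.hom 1).hom).baseChange ℂ)
      (if kt.2 = 0 then μ kt.1 else starRingEnd ℂ (μ kt.1)) ≠ ⊥)
    (htop : (⨆ kt : ι × Fin 2, Module.End.eigenspace (((bettiCohomology.map φE.hom.hom.hom 1).hom).baseChange ℂ)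
      (if kt.2 = 0 then μ kt.1 else starRingEnd ℂ (μ kt.1))) = ⊤)
    (hKE : ∀ k, Module.End.eigenspace (((bettiCohomology.map φE.hom.hom.hom 1).hom).baseChange ℂ) (μ k) ≤
      Module.End.eigenspace (((bettiCohomology.map φ.hom.hom.hom 1).hom).baseChange ℂ) (Complex.I * (Real.sqrt d : ℂ)))
    (hKE' : ∀ k, Module.End.eigenspace (((bettiCohomology.map φE.hom.hom.hom 1).hom).baseChange ℂ) (starRingEnd ℂ (μ k)) ≤
      Module.End.eigenspace (((bettiCohomology.map φ.hom.hom.hom 1).hom).baseChange ℂ) (-(Complex.I * (Real.sqrt d : ℂ))))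
    (ψ : (BettiUniverse.hodge exists_isReal_hodgeModel_holds (AbelianVariety.isSmoothProjective_holds (A := A)) 1).Polarization)
    (hSU : ∀ (Y : Module.End ℂ (ℂ ⊗[ℚ] bettiCohomology A.X 1))
      (hYφ : Y * ((bettiCohomology.map φ.hom.hom.hom 1).hom).baseChange ℂ =
        ((bettiCohomology.map φ.hom.hom.hom 1).hom).baseChange ℂ * Y),
      Y * ((bettiCohomology.map φE.hom.hom.hom 1).hom).baseChange ℂ =
        ((bettiCohomology.map φE.hom.hom.hom 1).hom).baseChange ℂ * Y →
      (∀ x y, ψ.form.baseChange ℂ (Y x) y + ψ.form.baseChange ℂ x (Y y) = 0) →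
      LinearMap.trace ℂ _ (Y.restrict fun x (hx : x ∈ Module.End.eigenspace
          (((bettiCohomology.map φ.hom.hom.hom 1).hom).baseChange ℂ) (Complex.I * (Real.sqrt d : ℂ))) =>
        UnitaryTheta.apply_mem_eigenspace_of_commute hYφ hx) = 0 →
      Y ∈ (BettiUniverse.hodge exists_isReal_hodgeModel_holds (AbelianVariety.isSmoothProjective_holds (A := A)) 1).hodgeLieC)
    {v₀ : (ℂ ⊗[ℚ] bettiCohomology A.X 1) ≃ₗ[ℂ] (ℂ ⊗[ℚ] bettiCohomology A.X 1)}
    (hvφ : (v₀ : Module.End ℂ (ℂ ⊗[ℚ] bettiCohomology A.X 1)) * ((bettiCohomology.map φ.hom.hom.hom 1).hom).baseChange ℂ =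
      ((bettiCohomology.map φ.hom.hom.hom 1).hom).baseChange ℂ * (v₀ : Module.End ℂ (ℂ ⊗[ℚ] bettiCohomology A.X 1)))
    (hvφE : (v₀ : Module.End ℂ (ℂ ⊗[ℚ] bettiCohomology A.X 1)) * ((bettiCohomology.map φE.hom.hom.hom 1).hom).baseChange ℂ =
      ((bettiCohomology.map φE.hom.hom.hom 1).hom).baseChange ℂ * (v₀ : Module.End ℂ (ℂ ⊗[ℚ] bettiCohomology A.X 1)))
    (hvψ : ∀ x y, ψ.form.baseChange ℂ (v₀ x) (v₀ y) = ψ.form.baseChange ℂ x y)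
    (hdet : LinearMap.det ((v₀ : Module.End ℂ (ℂ ⊗[ℚ] bettiCohomology A.X 1)).restrict
      fun x (hx : x ∈ Module.End.eigenspace (((bettiCohomology.map φ.hom.hom.hom 1).hom).baseChange ℂ)
        (Complex.I * (Real.sqrt d : ℂ))) => UnitaryTheta.apply_mem_eigenspace_of_commute hvφ hx) = 1) :
    (ofRatClassBaseChangeEquiv (AbelianVariety.isSmoothProjective_holds (A := A)) 1).symm.trans
        (v₀.trans (ofRatClassBaseChangeEquiv (AbelianVariety.isSmoothProjective_holds (A := A)) 1)) ∈
      hodgeGroupOne A.dim A.X := by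
  classical
  -- the setting
  have hHD : exists_isReal_hodgeModel := exists_isReal_hodgeModel_holds
  have hI : hodgePQ_independent_of_hodgeModel := hodgePQ_independent_of_hodgeModel_holds
  have hX : IsSmoothProjective A.dim A.X := AbelianVariety.isSmoothProjective_holds
  haveI : Module.Finite ℚ (bettiCohomology A.X 1) := finite_bettiCohomology_one A
  have heff := BettiUniverse.hodge_isEffective hHD hX 1
  set φQ : Module.End ℚ (bettiCohomology A.X 1) := (bettiCohomology.map φ.hom.hom.hom 1).hom with hφQdef
  set φEQ : Module.End ℚ (bettiCohomology A.X 1) := (bettiCohomology.map φE.hom.hom.hom 1).hom with hφEQdef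
  set μK : ℂ := Complex.I * (Real.sqrt d : ℂ) with hμKdef
  have hμK0 : μK ≠ 0 := mul_ne_zero Complex.I_ne_zero
    (Complex.ofReal_ne_zero.2 (Real.sqrt_ne_zero'.2 (Nat.cast_pos.2 hW.d_pos)))
  have hμKne : -μK ≠ μK := fun h' => hμK0 (by
    have h2 : (2 : ℂ) * μK = 0 := by rw [two_mul]; nth_rw 1 [← h']; exact neg_add_cancel μK
    exact (mul_eq_zero.1 h2).resolve_left two_ne_zero)
  set ρ := ofRatClassBaseChangeEquiv hX 1 with hρ
  set v : complexBetti A.X 1 ≃ₗ[ℂ] complexBetti A.X 1 := ρ.symm.trans (v₀.trans ρ) with hvdef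
  have hv_apply : ∀ z, v z = ρ (v₀ (ρ.symm z)) := fun z => rfl
  -- `End_Hdg = ℚ[φ_E^*]`
  have hφEE : φEQ ∈ (BettiUniverse.hodge hHD (AbelianVariety.isSmoothProjective_holds (A := A)) 1).endAlg := by
    have h := unop_bettiRep_mem_endAlg hHD hI (AbelianVariety.endAlgebra.of A φE)
    rwa [bettiRep_of, MulOpposite.unop_op] at h
  set ev : ι × Fin 2 → ℂ := fun kt => if kt.2 = 0 then μ kt.1 else starRingEnd ℂ (μ kt.1) with hevdef
  have hev0 : ∀ k, ev (k, 0) = μ k := fun k => by simp [hevdef]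
  have hev1 : ∀ k, ev (k, 1) = starRingEnd ℂ (μ k) := fun k => by simp [hevdef]
  have hev : Function.Injective ev := by
    rintro ⟨k, t⟩ ⟨k', t'⟩ h
    rcases fin2_cases₆ t with rfl | rfl <;> rcases fin2_cases₆ t' with rfl | rfl
    · rw [hev0, hev0] at h; rw [hinj h]
    · rw [hev0, hev1] at h; exact absurd h (hdist k' k)
    · rw [hev1, hev0] at h; exact absurd h.symm (hdist k k')
    · rw [hev1, hev1] at h; rw [hinj ((starRingEnd ℂ).injective h)]
  have hcard : Fintype.card (ι × Fin 2) = 2 * Fintype.card ι := by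
    rw [Fintype.card_prod, Fintype.card_fin, mul_comm]
  set eι : ι × Fin 2 ≃ Fin (2 * Fintype.card ι) := Fintype.equivFinOfCardEq hcard with heιdef
  have hEφ := exists_eq_sum_smul_pow_bettiMapHom_fin hHD hI φE hEcard (ev ∘ eι.symm) (hev.comp eι.symm.injective)
    fun j => hWne (eι.symm j)
  -- blocked adapted dual letters (S2)
  obtain ⟨n₀, cb, κ, blk, hcbE, hcbE', hcb0, hcb1, hdual, hiso⟩ := CMTheta.exists_blockedAdaptedDualBasis
    (BettiUniverse.hodge hHD (AbelianVariety.isSmoothProjective_holds (A := A)) 1) Nat.cast_one heff ψ hφEE hEφ μ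
    hinj hdist htop
  have hKcb : ∀ ℓ, cb (0, ℓ) ∈ Module.End.eigenspace (φQ.baseChange ℂ) μK := fun ℓ => hKE (blk ℓ) (hcbE ℓ)
  have hKcb' : ∀ ℓ, cb (1, ℓ) ∈ Module.End.eigenspace (φQ.baseChange ℂ) (-μK) := fun ℓ => hKE' (blk ℓ) (hcbE' ℓ)
  have hφcb : ∀ t ℓ, φQ.baseChange ℂ (cb (t, ℓ)) = (if t = 0 then μK else -μK) • cb (t, ℓ) := by
    intro t ℓ
    rcases fin2_cases₆ t with rfl | rfl
    · rw [if_pos rfl]; exact Module.End.mem_eigenspace_iff.1 (hKcb ℓ)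
    · rw [if_neg one_ne_zero]; exact Module.End.mem_eigenspace_iff.1 (hKcb' ℓ)
  have hφEcb0 : ∀ ℓ, φEQ.baseChange ℂ (cb (0, ℓ)) = μ (blk ℓ) • cb (0, ℓ) := fun ℓ =>
    Module.End.mem_eigenspace_iff.1 (hcbE ℓ)
  -- bases of `W_K`, `W̄_K` made of the letters
  obtain ⟨bW, hbW⟩ := exists_basis_eigenspace_of_block cb (f := φQ.baseChange ℂ)
    (ε := fun t => if t = 0 then μK else -μK) hφcb 0 (if_pos rfl) (fun t' ht' => by
      rcases fin2_cases₆ t' with rfl | rfl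
      · exact absurd rfl ht'
      · rw [if_neg one_ne_zero]; exact hμKne)
  obtain ⟨bW', hbW'⟩ := exists_basis_eigenspace_of_block cb (f := φQ.baseChange ℂ)
    (ε := fun t => if t = 0 then μK else -μK) hφcb 1 (if_neg one_ne_zero) (fun t' ht' => by
      rcases fin2_cases₆ t' with rfl | rfl
      · rw [if_pos rfl]; exact fun h' => hμKne h'.symm
      · exact absurd rfl ht')
  -- `v₀` preserves `W_K` and `W̄_K`; its matrices `M`, `N` on the letters
  have hvW : ∀ x ∈ Module.End.eigenspace (φQ.baseChange ℂ) μK, v₀ x ∈ Module.End.eigenspace (φQ.baseChange ℂ) μK :=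
    fun x hx => UnitaryTheta.apply_mem_eigenspace_of_commute hvφ hx
  have hvW' : ∀ x ∈ Module.End.eigenspace (φQ.baseChange ℂ) (-μK),
      v₀ x ∈ Module.End.eigenspace (φQ.baseChange ℂ) (-μK) :=
    fun x hx => UnitaryTheta.apply_mem_eigenspace_of_commute hvφ hx
  set M : Matrix (Fin n₀) (Fin n₀) ℂ := Matrix.of fun r ℓ => bW.repr ⟨v₀ (cb (0, ℓ)), hvW _ (hKcb ℓ)⟩ r with hMdef
  set N : Matrix (Fin n₀) (Fin n₀) ℂ := Matrix.of fun r ℓ => bW'.repr ⟨v₀ (cb (1, ℓ)), hvW' _ (hKcb' ℓ)⟩ r with hNdef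
  have hM : ∀ ℓ, v₀ (cb (0, ℓ)) = ∑ r, M r ℓ • cb (0, r) := fun ℓ => by
    have hs := congrArg Subtype.val (bW.sum_repr ⟨v₀ (cb (0, ℓ)), hvW _ (hKcb ℓ)⟩)
    rw [Submodule.coe_sum] at hs
    change _ = v₀ (cb (0, ℓ)) at hs
    rw [← hs]
    exact Finset.sum_congr rfl fun r _ => by rw [Submodule.coe_smul, hbW, hMdef, Matrix.of_apply]
  have hN : ∀ ℓ, v₀ (cb (1, ℓ)) = ∑ r, N r ℓ • cb (1, r) := fun ℓ => by
    have hs := congrArg Subtype.val (bW'.sum_repr ⟨v₀ (cb (1, ℓ)), hvW' _ (hKcb' ℓ)⟩)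
    rw [Submodule.coe_sum] at hs
    change _ = v₀ (cb (1, ℓ)) at hs
    rw [← hs]
    exact Finset.sum_congr rfl fun r _ => by rw [Submodule.coe_smul, hbW', hNdef, Matrix.of_apply]
  -- `M` is block-diagonal: `v₀` commutes with `φ_{E,ℂ}`
  have hMb : ∀ r ℓ, blk r ≠ blk ℓ → M r ℓ = 0 := by
    intro r ℓ hb
    have hli : LinearIndependent ℂ fun r : Fin n₀ => cb (0, r) :=
      cb.linearIndependent.comp (fun r => (0, r)) fun r r' h => by simpa using h
    refine matrix_entry_eq_zero_of_comm_of_eigen hli (f := φEQ.baseChange ℂ)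
      (Y := (v₀ : Module.End ℂ (ℂ ⊗[ℚ] bettiCohomology A.X 1))) (ε := fun r => μ (blk r)) hφEcb0 M
      (fun ℓ => by rw [LinearEquiv.coe_coe, hM]) (fun ℓ => ?_) (hinj.ne hb)
    have h3 := LinearMap.congr_fun hvφE (cb (0, ℓ))
    simpa only [Module.End.mul_apply, LinearEquiv.coe_coe] using h3
  -- `det M = det(v₀|_W_K) = 1`
  have hdetM : M.det = 1 := by
    rw [← hdet]
    exact (det_restrict_eq_of_apply_eq_sum bW hbW _ M hM).symm
  -- `Mᵀ N = 1` (duality of the letters and `ψ_ℂ`-invariance), so `N = (M⁻¹)ᵀ`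
  have hMN : Mᵀ * N = 1 := by
    ext i j
    have h1 := hvψ (cb (0, i)) (cb (1, j))
    rw [hM, hN, hdual] at h1
    simp only [map_sum, LinearMap.sum_apply, map_smul, LinearMap.smul_apply, smul_eq_mul, hdual, mul_ite, mul_one,
      mul_zero, Finset.sum_ite_eq', Finset.mem_univ, if_true] at h1
    rw [Matrix.mul_apply, Matrix.one_apply, ← h1]
    exact Finset.sum_congr rfl fun r _ => by rw [Matrix.transpose_apply, mul_comm]
  have hNeq : N = (M⁻¹)ᵀ := by
    rw [Matrix.transpose_nonsing_inv, Matrix.inv_eq_right_inv hMN]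
  -- the block family of `v₀` on the letters
  set Gm : Fin 2 → Matrix (Fin n₀) (Fin n₀) ℂ := fun t => if t = 0 then M else (M⁻¹)ᵀ with hGm
  have hv₀cb : ∀ t ℓ, v₀ (cb (t, ℓ)) = ∑ r, Gm t r ℓ • cb (t, r) := by
    intro t ℓ
    rcases fin2_cases₆ t with rfl | rfl
    · simp only [hGm, if_pos rfl]; exact hM ℓ
    · simp only [hGm, if_neg one_ne_zero, ← hNeq]; exact hN ℓ
  -- the letters in `H¹(A(ℂ); ℂ)` and the action of `v` on them
  set x : Fin 2 × Fin n₀ → complexBetti A.X 1 := fun tl => ofRatClassBaseChange (Motives.ComplexPoints A.X) 1 (cb tl)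
    with hxdef
  have hxρ : ∀ tl, x tl = ρ (cb tl) := fun tl => by rw [hxdef, hρ, ofRatClassBaseChangeEquiv_apply]
  have hvx : ∀ t ℓ, v (x (t, ℓ)) = ∑ r, Gm t r ℓ • x (t, r) := fun t ℓ => by
    rw [hxρ, hv_apply, ρ.symm_apply_apply, hv₀cb, map_sum]
    exact Finset.sum_congr rfl fun r _ => by rw [map_smul, hxρ]
  -- `v` commutes with `φ_E^*`, hence with every pull-back (`End_Hdg = ℚ[φ_E^*]`): `v ∈ C(A)^×(ℂ)`
  have hvφE' : ∀ z, v (pullbackOne A φE z) = pullbackOne A φE (v z) := fun z => by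
    rw [hv_apply, hv_apply]
    have h1 : ρ.symm (pullbackOne A φE z) = φEQ.baseChange ℂ (ρ.symm z) := by
      apply ρ.injective
      rw [ρ.apply_symm_apply, hρ, ofRatClassBaseChangeEquiv_apply, hφEQdef, ofRatClassBaseChange_baseChange_bettiMapHom,
        ← ofRatClassBaseChangeEquiv_apply hX, LinearEquiv.apply_symm_apply]
    have h2 : v₀ (φEQ.baseChange ℂ (ρ.symm z)) = φEQ.baseChange ℂ (v₀ (ρ.symm z)) := by
      have h3 := LinearMap.congr_fun hvφE (ρ.symm z)
      simpa only [Module.End.mul_apply, LinearEquiv.coe_coe] using h3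
    rw [h1, h2, hρ, ofRatClassBaseChangeEquiv_apply, hφEQdef, ofRatClassBaseChange_baseChange_bettiMapHom,
      ← ofRatClassBaseChangeEquiv_apply hX]
  have hvC : v ∈ centralizerGroup A := mem_centralizerGroup_of_comm_pullbackOne_of_endAlg_eq_polynomial hEφ hvφE'
  -- `⋀•(v^{⊕(a+1)})` fixes every rational `(p,p)`-class of every power
  have key : ∀ (a p : ℕ) (c : complexBetti (A.powSucc a).X (2 * p)), IsRationalClass c →
      IsOfHodgeType (A.powSucc a).dim (A.powSucc a).X (2 * p) p p c → diagPowExterior A v a (2 * p) c = c := by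
    intro a p c hcQ hc
    rcases Nat.eq_zero_or_pos p with rfl | hp
    · -- degree `0`: `c = t • 1` and `⋀⁰ = id` on `1`
      obtain ⟨t, rfl⟩ := exists_eq_smul_one_of_isSmoothProjective
        (AbelianVariety.isSmoothProjective_holds (A := A.powSucc a)) ℂ c
      rw [map_smul]
      congr 1
      show diagPowExterior A v a 0 _ = _
      rw [diagPowExterior, exteriorPullbackEquiv_apply, exteriorPullback_one]
    · obtain ⟨cf, hcf, hkill⟩ := (AVSlots.powSucc A a).exists_blockSlInvariant_coeff_of_hodgeLieC hHD hI ψ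
        hμKne hSU μ cb κ blk hcbE hcbE' hKcb hKcb' hcb0 hcb1 hdual hiso hp hcQ hc
      rw [← hcf, diagPowExterior_wordEval_avLetters_eq_wordEval_colourChangeAt hvC x Gm hvx a (2 * p) cf,
        colourChangeAt_eq_self_of_forall_wordSlice]
      intro U
      set ty : Fin (2 * p) → Bool := fun q => decide ((U q).2 = 0) with hty
      have hfamG : (fun q => Gm (U q).2) = mixedGrpFamily ty M := by
        funext q
        by_cases hq : (U q).2 = 0
        · rw [hq, mixedGrpFamily_of_eq_true M (by simp [hty, hq])]
          exact if_pos rfl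
        · have hq1 : (U q).2 = 1 := (fin2_cases₆ _).resolve_left hq
          rw [hq1, mixedGrpFamily_of_eq_false M (by simp [hty, hq1])]
          exact if_neg one_ne_zero
      rw [hfamG]
      refine wordRepAt_mixedGrpFamily_eq_self_of_forall_blockDiag_trace_of_det_eq_one blk ty
        (fun X hXb hXtr => ?_) hMb hdetM
      have hfam : mixedLieFamily ty X = fun t => if (U t).2 = 0 then X else -Xᵀ := by
        funext t
        simp only [mixedLieFamily, hty, decide_eq_true_eq]
      rw [hfam]
      exact hkill U X hXb hXtr
  have hmem := exteriorPullbackEquiv_mem_hodgeGroup_of_forall key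
  exact mem_hodgeGroupOne_iff.2 ⟨_, hmem, exteriorPullbackEquiv_one_eq _ v⟩

end BlockedLeHg

/-! ### §3 THE SOCKET: `S(A)(h)(ℂ) ∩ {det_{W_K} = 1} ⊆ Hg(A)(ℂ)|_{H¹}` for `End⁰ = ℚ[φ_E] ⊋ K` with any multiplicities — the displayed `hG` of TABLE X rows 17 ∕ 22 -/

section SocketP

variable {A : AbelianVariety ℂ} {φ : A ⟶ A} {n d : ℕ} {ι : Type} [Fintype ι] [DecidableEq ι]

open scoped Classical in
/-- **B5a-P — THE LIE-TO-GROUP PASSAGE FOR WEIL TYPE WITH `End⁰ = ℚ[φ_E] ⊋ K` AND UNEQUAL MULTIPLICITIES** (socket `hG` of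
the TABLE X census file `SixfoldTableXCensusWeilProductRowsGeneral`, rows 17 ∕ 22). Let `(A, φ)` be of Weil type `(n, d)`,
`φ_E ∈ End(A)` with `finrank_ℚ End⁰(A) = 2|ι|` and colours `μ : ι → ℂ` as in §2 (`W_{μ k}`, `W_{μ̄ k}` non-zero, spanning,
the `K`-fibre), `ψ` a polarization of `H¹(A(ℂ); ℚ)` with the DISPLAYED Lie hypothesis `hSU` («every operator commuting with
`φ_ℂ` and `φ_{E,ℂ}`, `ψ_ℂ`-skew, with trace `0` on `W_K`, lies in `Lie Hg(H¹A) ⊗ ℂ`»), and `h ∈ B¹(A) ⊗ ℂ` with `Q_h`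
non-degenerate and `φ^*` a `d`-similitude of `Q_h`. Then every `u ∈ S(A)(h)(ℂ) = unitaryCentralizerGroup A h` with
`det(u | W_K) = 1` lies in `Hg(A)(ℂ)|_{H¹}`. Proof (B5a §4's `u = v` trick): `u` commutes with `φ^*` and `φ_E^*`, so its
matrix `M` on the `W_K`-letters is block-diagonal with `det M = 1`, and so is `(M⁻¹)ᵀ`; the operator `v = (M, (M⁻¹)ᵀ)` on
`W_K ⊕ W̄_K` commutes with `φ_ℂ` and `φ_{E,ℂ}`, preserves `ψ_ℂ`, has `det(v|W_K) = 1`, hence `v ∈ Hg|_{H¹}` (§2)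
`≤ S(A)(h)`; `u` and `v` preserve `Q_h` and agree on `W_K`, and `W̄_K` is `Q_h`-isotropic, so `u = v`. NOT proved here:
`hSU` (the row's Lie theorem), HC for any row. [cite: Deligne1982HodgeCycles, I §3 Prop. 3.4 and 3.6]
[cite: vanGeemen1994HodgeAV, 6.9 and Lemma 6.10] [cite: Milne1999LefschetzClasses, §1 p. 644 and §4 p. 659]
[cite: GoodmanWallachGTM255, Thm. 2.2.2 and Thm. 2.2.7 (2)] [cite: MoonenZarhin1999LowDim, §5 (5.11)] -/
theorem IsWeilType.mem_hodgeGroupOne_of_mem_unitaryCentralizerGroup_blocked_of_hodgeLieC [HodgeTensorFacts.{0, 0}]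
    (hW : IsWeilType A φ n d) (φE : A ⟶ A) (hEcard : Module.finrank ℚ A.endAlgebra = 2 * Fintype.card ι)
    (μ : ι → ℂ) (hinj : Function.Injective μ) (hdist : ∀ k k', μ k' ≠ starRingEnd ℂ (μ k))
    (hWne : ∀ kt : ι × Fin 2, Module.End.eigenspace (((bettiCohomology.map φE.hom.hom.hom 1).hom).baseChange ℂ)
      (if kt.2 = 0 then μ kt.1 else starRingEnd ℂ (μ kt.1)) ≠ ⊥)
    (htop : (⨆ kt : ι × Fin 2, Module.End.eigenspace (((bettiCohomology.map φE.hom.hom.hom 1).hom).baseChange ℂ)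
      (if kt.2 = 0 then μ kt.1 else starRingEnd ℂ (μ kt.1))) = ⊤)
    (hKE : ∀ k, Module.End.eigenspace (((bettiCohomology.map φE.hom.hom.hom 1).hom).baseChange ℂ) (μ k) ≤
      Module.End.eigenspace (((bettiCohomology.map φ.hom.hom.hom 1).hom).baseChange ℂ) (Complex.I * (Real.sqrt d : ℂ)))
    (hKE' : ∀ k, Module.End.eigenspace (((bettiCohomology.map φE.hom.hom.hom 1).hom).baseChange ℂ) (starRingEnd ℂ (μ k)) ≤
      Module.End.eigenspace (((bettiCohomology.map φ.hom.hom.hom 1).hom).baseChange ℂ) (-(Complex.I * (Real.sqrt d : ℂ))))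
    (ψ : (BettiUniverse.hodge exists_isReal_hodgeModel_holds (AbelianVariety.isSmoothProjective_holds (A := A)) 1).Polarization)
    (hSU : ∀ (Y : Module.End ℂ (ℂ ⊗[ℚ] bettiCohomology A.X 1))
      (hYφ : Y * ((bettiCohomology.map φ.hom.hom.hom 1).hom).baseChange ℂ =
        ((bettiCohomology.map φ.hom.hom.hom 1).hom).baseChange ℂ * Y),
      Y * ((bettiCohomology.map φE.hom.hom.hom 1).hom).baseChange ℂ =
        ((bettiCohomology.map φE.hom.hom.hom 1).hom).baseChange ℂ * Y →
      (∀ x y, ψ.form.baseChange ℂ (Y x) y + ψ.form.baseChange ℂ x (Y y) = 0) →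
      LinearMap.trace ℂ _ (Y.restrict fun x (hx : x ∈ Module.End.eigenspace
          (((bettiCohomology.map φ.hom.hom.hom 1).hom).baseChange ℂ) (Complex.I * (Real.sqrt d : ℂ))) =>
        UnitaryTheta.apply_mem_eigenspace_of_commute hYφ hx) = 0 →
      Y ∈ (BettiUniverse.hodge exists_isReal_hodgeModel_holds (AbelianVariety.isSmoothProjective_holds (A := A)) 1).hodgeLieC)
    {h : complexBetti A.X 2} (hh : h ∈ hodgeClassSpan A.dim A.X 1)
    (hnd : ∀ x : complexBetti A.X 1, (∀ y, Motives.polarizationPairingOne A.X h (A.dim - 1) x y = 0) → x = 0)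
    (hφQ : ∀ x y, Motives.polarizationPairingOne A.X h (A.dim - 1) (pullbackOne A φ x) (pullbackOne A φ y) =
      (d : ℂ) • Motives.polarizationPairingOne A.X h (A.dim - 1) x y)
    (u : complexBetti A.X 1 ≃ₗ[ℂ] complexBetti A.X 1) (hu : u ∈ unitaryCentralizerGroup A h)
    (hdet : detOnEigenspace u (pullbackOne A φ) (fun x ↦ (mem_centralizerGroup_iff.1 hu.1) φ x)
      (Complex.I * (Real.sqrt d : ℂ)) = 1) :
    u ∈ hodgeGroupOne A.dim A.X := by
  classical
  -- the setting
  have hHD : exists_isReal_hodgeModel := exists_isReal_hodgeModel_holds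
  have hI : hodgePQ_independent_of_hodgeModel := hodgePQ_independent_of_hodgeModel_holds
  have hX : IsSmoothProjective A.dim A.X := AbelianVariety.isSmoothProjective_holds
  haveI : Module.Finite ℚ (bettiCohomology A.X 1) := finite_bettiCohomology_one A
  have heff := BettiUniverse.hodge_isEffective hHD hX 1
  set φQ : Module.End ℚ (bettiCohomology A.X 1) := (bettiCohomology.map φ.hom.hom.hom 1).hom with hφQdef
  set φEQ : Module.End ℚ (bettiCohomology A.X 1) := (bettiCohomology.map φE.hom.hom.hom 1).hom with hφEQdef
  set μK : ℂ := Complex.I * (Real.sqrt d : ℂ) with hμKdef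
  have hμK0 : μK ≠ 0 := mul_ne_zero Complex.I_ne_zero
    (Complex.ofReal_ne_zero.2 (Real.sqrt_ne_zero'.2 (Nat.cast_pos.2 hW.d_pos)))
  have hμKne : -μK ≠ μK := fun h' => hμK0 (by
    have h2 : (2 : ℂ) * μK = 0 := by rw [two_mul]; nth_rw 1 [← h']; exact neg_add_cancel μK
    exact (mul_eq_zero.1 h2).resolve_left two_ne_zero)
  have hμK2 : μK * μK = -(d : ℂ) := by
    rw [hμKdef, mul_mul_mul_comm, Complex.I_mul_I, ← Complex.ofReal_mul, Real.mul_self_sqrt (Nat.cast_nonneg d),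
      Complex.ofReal_natCast, neg_one_mul]
  set ρ := ofRatClassBaseChangeEquiv hX 1 with hρ
  set Q := Motives.polarizationPairingOne A.X h (A.dim - 1) with hQdef
  have hρφ : ∀ z, ρ (φQ.baseChange ℂ z) = pullbackOne A φ (ρ z) := fun z => by
    rw [hρ, ofRatClassBaseChangeEquiv_apply, ofRatClassBaseChangeEquiv_apply, hφQdef,
      ofRatClassBaseChange_baseChange_bettiMapHom]
  have hρφE : ∀ z, ρ (φEQ.baseChange ℂ z) = pullbackOne A φE (ρ z) := fun z => by
    rw [hρ, ofRatClassBaseChangeEquiv_apply, ofRatClassBaseChangeEquiv_apply, hφEQdef,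
      ofRatClassBaseChange_baseChange_bettiMapHom]
  -- `End_Hdg = ℚ[φ_E^*]` and the blocked letters (as in §2)
  have hφEE : φEQ ∈ (BettiUniverse.hodge hHD (AbelianVariety.isSmoothProjective_holds (A := A)) 1).endAlg := by
    have h' := unop_bettiRep_mem_endAlg hHD hI (AbelianVariety.endAlgebra.of A φE)
    rwa [bettiRep_of, MulOpposite.unop_op] at h'
  set ev : ι × Fin 2 → ℂ := fun kt => if kt.2 = 0 then μ kt.1 else starRingEnd ℂ (μ kt.1) with hevdef
  have hev0 : ∀ k, ev (k, 0) = μ k := fun k => by simp [hevdef]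
  have hev1 : ∀ k, ev (k, 1) = starRingEnd ℂ (μ k) := fun k => by simp [hevdef]
  have hev : Function.Injective ev := by
    rintro ⟨k, t⟩ ⟨k', t'⟩ h'
    rcases fin2_cases₆ t with rfl | rfl <;> rcases fin2_cases₆ t' with rfl | rfl
    · rw [hev0, hev0] at h'; rw [hinj h']
    · rw [hev0, hev1] at h'; exact absurd h' (hdist k' k)
    · rw [hev1, hev0] at h'; exact absurd h'.symm (hdist k k')
    · rw [hev1, hev1] at h'; rw [hinj ((starRingEnd ℂ).injective h')]
  have hcard : Fintype.card (ι × Fin 2) = 2 * Fintype.card ι := by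
    rw [Fintype.card_prod, Fintype.card_fin, mul_comm]
  set eι : ι × Fin 2 ≃ Fin (2 * Fintype.card ι) := Fintype.equivFinOfCardEq hcard with heιdef
  have hEφ := exists_eq_sum_smul_pow_bettiMapHom_fin hHD hI φE hEcard (ev ∘ eι.symm) (hev.comp eι.symm.injective)
    fun j => hWne (eι.symm j)
  obtain ⟨n₀, cb, κ, blk, hcbE, hcbE', hcb0, hcb1, hdual, hiso⟩ := CMTheta.exists_blockedAdaptedDualBasis
    (BettiUniverse.hodge hHD (AbelianVariety.isSmoothProjective_holds (A := A)) 1) Nat.cast_one heff ψ hφEE hEφ μ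
    hinj hdist htop
  have hKcb : ∀ ℓ, cb (0, ℓ) ∈ Module.End.eigenspace (φQ.baseChange ℂ) μK := fun ℓ => hKE (blk ℓ) (hcbE ℓ)
  have hKcb' : ∀ ℓ, cb (1, ℓ) ∈ Module.End.eigenspace (φQ.baseChange ℂ) (-μK) := fun ℓ => hKE' (blk ℓ) (hcbE' ℓ)
  have hφcb : ∀ t ℓ, φQ.baseChange ℂ (cb (t, ℓ)) = (if t = 0 then μK else -μK) • cb (t, ℓ) := by
    intro t ℓ
    rcases fin2_cases₆ t with rfl | rfl
    · rw [if_pos rfl]; exact Module.End.mem_eigenspace_iff.1 (hKcb ℓ)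
    · rw [if_neg one_ne_zero]; exact Module.End.mem_eigenspace_iff.1 (hKcb' ℓ)
  have hφEcb : ∀ t ℓ, φEQ.baseChange ℂ (cb (t, ℓ)) =
      (if t = 0 then μ (blk ℓ) else starRingEnd ℂ (μ (blk ℓ))) • cb (t, ℓ) := by
    intro t ℓ
    rcases fin2_cases₆ t with rfl | rfl
    · rw [if_pos rfl]; exact Module.End.mem_eigenspace_iff.1 (hcbE ℓ)
    · rw [if_neg one_ne_zero]; exact Module.End.mem_eigenspace_iff.1 (hcbE' ℓ)
  -- the letters in `H¹(A(ℂ); ℂ)`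
  set xb : Module.Basis (Fin 2 × Fin n₀) ℂ (complexBetti A.X 1) := cb.map ρ with hxb
  have hxb_apply : ∀ tl, xb tl = ρ (cb tl) := fun tl => by rw [hxb, Module.Basis.map_apply]
  have hφxb : ∀ t ℓ, pullbackOne A φ (xb (t, ℓ)) = (if t = 0 then μK else -μK) • xb (t, ℓ) := fun t ℓ => by
    rw [hxb_apply, ← hρφ, hφcb, map_smul]
  have hφExb0 : ∀ ℓ, pullbackOne A φE (xb (0, ℓ)) = μ (blk ℓ) • xb (0, ℓ) := fun ℓ => by
    rw [hxb_apply, ← hρφE, hφEcb, if_pos rfl, map_smul]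
  -- bases of `W_K` on both sides made of the letters
  obtain ⟨bW, hbW⟩ := exists_basis_eigenspace_of_block cb (f := φQ.baseChange ℂ)
    (ε := fun t => if t = 0 then μK else -μK) hφcb 0 (if_pos rfl) (fun t' ht' => by
      rcases fin2_cases₆ t' with rfl | rfl
      · exact absurd rfl ht'
      · rw [if_neg one_ne_zero]; exact hμKne)
  obtain ⟨bWc, hbWc⟩ := exists_basis_eigenspace_of_block xb (f := pullbackOne A φ)
    (ε := fun t => if t = 0 then μK else -μK) hφxb 0 (if_pos rfl) (fun t' ht' => by
      rcases fin2_cases₆ t' with rfl | rfl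
      · exact absurd rfl ht'
      · rw [if_neg one_ne_zero]; exact hμKne)
  -- the matrix `M` of `u|_W_K` on the letters; block-diagonal; `det M = 1`
  have huφ : ∀ z, u (pullbackOne A φ z) = pullbackOne A φ (u z) := fun z => (mem_centralizerGroup_iff.1 hu.1) φ z
  have huφE : ∀ z, u (pullbackOne A φE z) = pullbackOne A φE (u z) := fun z => (mem_centralizerGroup_iff.1 hu.1) φE z
  have huW : ∀ x ∈ Module.End.eigenspace (pullbackOne A φ) μK, (u : complexBetti A.X 1 →ₗ[ℂ] complexBetti A.X 1) x ∈
      Module.End.eigenspace (pullbackOne A φ) μK :=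
    fun x hx => VanGeemen1994.mapsTo_eigenspace_of_comm huφ μK hx
  have hxbW : ∀ ℓ, xb (0, ℓ) ∈ Module.End.eigenspace (pullbackOne A φ) μK := fun ℓ =>
    Module.End.mem_eigenspace_iff.2 (by rw [hφxb, if_pos rfl])
  set M : Matrix (Fin n₀) (Fin n₀) ℂ := Matrix.of fun r ℓ => bWc.repr ⟨u (xb (0, ℓ)), huW _ (hxbW ℓ)⟩ r with hMdef
  have hMu : ∀ ℓ, u (xb (0, ℓ)) = ∑ r, M r ℓ • xb (0, r) := fun ℓ => by
    have hs := congrArg Subtype.val (bWc.sum_repr ⟨u (xb (0, ℓ)), huW _ (hxbW ℓ)⟩)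
    rw [Submodule.coe_sum] at hs
    change _ = u (xb (0, ℓ)) at hs
    rw [← hs]
    exact Finset.sum_congr rfl fun r _ => by rw [Submodule.coe_smul, hbWc, hMdef, Matrix.of_apply]
  have hMb : ∀ r ℓ, blk r ≠ blk ℓ → M r ℓ = 0 := by
    intro r ℓ hb
    have hli : LinearIndependent ℂ fun r : Fin n₀ => xb (0, r) :=
      xb.linearIndependent.comp (fun r => (0, r)) fun r r' h' => by simpa using h'
    exact matrix_entry_eq_zero_of_comm_of_eigen hli (f := pullbackOne A φE)
      (Y := (u : complexBetti A.X 1 →ₗ[ℂ] complexBetti A.X 1)) (ε := fun r => μ (blk r)) hφExb0 M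
      (fun ℓ => by rw [LinearEquiv.coe_coe, hMu]) (fun ℓ => by rw [LinearEquiv.coe_coe, huφE]) (hinj.ne hb)
  have hdetM : M.det = 1 := by
    rw [← hdet]
    unfold detOnEigenspace
    exact (det_restrict_eq_of_apply_eq_sum bWc hbWc _ M hMu).symm
  have hMunit : IsUnit M.det := by rw [hdetM]; exact isUnit_one
  have hMinvM : M⁻¹ * M = 1 := Matrix.nonsing_inv_mul M hMunit
  have hMinvb : ∀ r ℓ, blk r ≠ blk ℓ → M⁻¹ r ℓ = 0 := fun r ℓ hb =>
    nonsing_inv_apply_eq_zero_of_blockDiag blk hinj hMb hMunit hb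
  -- the operator `v₀ = (M, (M⁻¹)ᵀ)` on `V_ℂ = W_K ⊕ W̄_K`
  set Gm : Fin 2 → Matrix (Fin n₀) (Fin n₀) ℂ := fun t => if t = 0 then M else (M⁻¹)ᵀ with hGm
  have hGm0 : Gm 0 = M := if_pos rfl
  have hGm1 : Gm 1 = (M⁻¹)ᵀ := if_neg one_ne_zero
  have hGmb : ∀ t r ℓ, blk r ≠ blk ℓ → Gm t r ℓ = 0 := by
    intro t r ℓ hb
    rcases fin2_cases₆ t with rfl | rfl
    · rw [hGm0]; exact hMb r ℓ hb
    · rw [hGm1, Matrix.transpose_apply]; exact hMinvb ℓ r (Ne.symm hb)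
  set cbr : Module.Basis (Fin n₀ × Fin 2) ℂ (ℂ ⊗[ℚ] bettiCohomology A.X 1) :=
    cb.reindex (Equiv.prodComm (Fin 2) (Fin n₀)) with hcbr
  have hcbr_apply : ∀ ℓ t, cbr (ℓ, t) = cb (t, ℓ) := fun ℓ t => by
    rw [hcbr, Module.Basis.reindex_apply]; rfl
  set P : Matrix (Fin n₀ × Fin 2) (Fin n₀ × Fin 2) ℂ := Matrix.blockDiagonal Gm with hP
  have hPunit : IsUnit (LinearMap.toMatrix cbr cbr (Matrix.toLin cbr cbr P)).det := by
    rw [LinearMap.toMatrix_toLin, hP, Matrix.det_blockDiagonal, Fin.prod_univ_two, hGm0, hGm1, Matrix.det_transpose,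
      Matrix.det_nonsing_inv, hdetM, Ring.inverse_one, one_mul]
    exact isUnit_one
  set v₀ : (ℂ ⊗[ℚ] bettiCohomology A.X 1) ≃ₗ[ℂ] (ℂ ⊗[ℚ] bettiCohomology A.X 1) :=
    LinearEquiv.ofIsUnitDet hPunit with hv₀
  have hv₀cb : ∀ t ℓ, v₀ (cb (t, ℓ)) = ∑ r, Gm t r ℓ • cb (t, r) := fun t ℓ => by
    rw [hv₀, LinearEquiv.ofIsUnitDet_apply, ← hcbr_apply, Matrix.toLin_self, Fintype.sum_prod_type_right,
      Finset.sum_eq_single t]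
    · exact Finset.sum_congr rfl fun r _ => by rw [hP, Matrix.blockDiagonal_apply_eq, hcbr_apply]
    · intro t' _ ht'
      exact Finset.sum_eq_zero fun r _ => by rw [hP, Matrix.blockDiagonal_apply_ne _ _ _ ht', zero_smul]
    · intro ht; exact absurd (Finset.mem_univ t) ht
  -- `v₀` commutes with `φ_ℂ` and with `φ_{E,ℂ}` (the blocks of `Gm t` are `blk`-diagonal)
  have hv₀φ : (v₀ : Module.End ℂ (ℂ ⊗[ℚ] bettiCohomology A.X 1)) * φQ.baseChange ℂ =
      φQ.baseChange ℂ * (v₀ : Module.End ℂ (ℂ ⊗[ℚ] bettiCohomology A.X 1)) := by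
    refine cb.ext fun tl => ?_
    obtain ⟨t, ℓ⟩ := tl
    rw [Module.End.mul_apply, Module.End.mul_apply, LinearEquiv.coe_coe, hφcb, map_smul, hv₀cb, map_sum,
      Finset.smul_sum]
    exact Finset.sum_congr rfl fun r _ => by rw [map_smul, hφcb, smul_comm]
  have hv₀φE : (v₀ : Module.End ℂ (ℂ ⊗[ℚ] bettiCohomology A.X 1)) * φEQ.baseChange ℂ =
      φEQ.baseChange ℂ * (v₀ : Module.End ℂ (ℂ ⊗[ℚ] bettiCohomology A.X 1)) := by
    refine cb.ext fun tl => ?_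
    obtain ⟨t, ℓ⟩ := tl
    rw [Module.End.mul_apply, Module.End.mul_apply, LinearEquiv.coe_coe, hφEcb, map_smul, hv₀cb, map_sum,
      Finset.smul_sum]
    refine Finset.sum_congr rfl fun r _ => ?_
    rw [map_smul, hφEcb]
    by_cases hb : blk r = blk ℓ
    · rw [hb, smul_comm]
    · rw [hGmb t r ℓ hb, zero_smul, zero_smul, smul_zero]
  -- `v₀` preserves `ψ_ℂ`
  set ψC := ψ.form.baseChange ℂ with hψC
  have hiso0 : ∀ i j, ψC (cb (0, i)) (cb (0, j)) = 0 := fun i j => hiso 0 i j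
  have hiso1 : ∀ i j, ψC (cb (1, i)) (cb (1, j)) = 0 := fun i j => hiso 1 i j
  have hswap10 : ∀ i j, ψC (cb (1, i)) (cb (0, j)) = -(if j = i then 1 else 0) := fun i j => by
    rw [hψC, ψ.form_baseChange_swap, show (((1 : ℕ) : ℤ)).negOnePow = -1 from Int.negOnePow_one, ← hψC, hdual]
    split_ifs <;> simp
  have hv₀ψ : ∀ x y, ψC (v₀ x) (v₀ y) = ψC x y := by
    have hB : ψC.compl₁₂ (v₀ : Module.End ℂ (ℂ ⊗[ℚ] bettiCohomology A.X 1))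
        (v₀ : Module.End ℂ (ℂ ⊗[ℚ] bettiCohomology A.X 1)) = ψC := by
      refine LinearMap.BilinForm.ext_basis cb fun tk tl => ?_
      obtain ⟨t, k⟩ := tk
      obtain ⟨t', ℓ⟩ := tl
      rw [LinearMap.compl₁₂_apply, LinearEquiv.coe_coe, hv₀cb, hv₀cb, bilin_apply_sum_smul_sum_smul₆]
      rcases fin2_cases₆ t with rfl | rfl <;> rcases fin2_cases₆ t' with rfl | rfl
      · simp only [hiso0, smul_zero, Finset.sum_const_zero]
      · have e1 : ∀ r : Fin n₀, ∑ s, (Gm 0 r k * Gm 1 s ℓ) • ψC (cb (0, r)) (cb (1, s)) = M r k * M⁻¹ ℓ r := by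
          intro r
          rw [Finset.sum_eq_single r]
          · rw [hdual, if_pos rfl, smul_eq_mul, mul_one, hGm0, hGm1, Matrix.transpose_apply]
          · intro s _ hs
            rw [hdual, if_neg (Ne.symm hs), smul_zero]
          · intro hr; exact absurd (Finset.mem_univ r) hr
        have e2 : ∑ r, M r k * M⁻¹ ℓ r = (M⁻¹ * M) ℓ k := by
          rw [Matrix.mul_apply]; exact Finset.sum_congr rfl fun r _ => mul_comm _ _
        rw [Finset.sum_congr rfl fun r _ => e1 r, e2, hMinvM, Matrix.one_apply, hdual]
        by_cases hkl : k = ℓ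
        · rw [if_pos hkl, if_pos hkl.symm]
        · rw [if_neg hkl, if_neg (Ne.symm hkl)]
      · have e1 : ∀ r : Fin n₀, ∑ s, (Gm 1 r k * Gm 0 s ℓ) • ψC (cb (1, r)) (cb (0, s)) = -(M⁻¹ k r * M r ℓ) := by
          intro r
          rw [Finset.sum_eq_single r]
          · rw [hswap10, if_pos rfl, smul_neg, smul_eq_mul, mul_one, hGm0, hGm1, Matrix.transpose_apply]
          · intro s _ hs
            rw [hswap10, if_neg hs, neg_zero, smul_zero]
          · intro hr; exact absurd (Finset.mem_univ r) hr
        have e2 : ∑ r, -(M⁻¹ k r * M r ℓ) = -(M⁻¹ * M) k ℓ := by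
          rw [Finset.sum_neg_distrib, Matrix.mul_apply]
        rw [Finset.sum_congr rfl fun r _ => e1 r, e2, hMinvM, Matrix.one_apply, hswap10]
        by_cases hkl : k = ℓ
        · rw [if_pos hkl, if_pos hkl.symm]
        · rw [if_neg hkl, if_neg (Ne.symm hkl)]
      · simp only [hiso1, smul_zero, Finset.sum_const_zero]
    intro x y
    have e := LinearMap.congr_fun (LinearMap.congr_fun hB x) y
    rw [LinearMap.compl₁₂_apply, LinearEquiv.coe_coe] at e
    exact e
  -- `det(v₀|_W_K) = det M = 1`
  have hv₀det : LinearMap.det ((v₀ : Module.End ℂ (ℂ ⊗[ℚ] bettiCohomology A.X 1)).restrict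
      fun x (hx : x ∈ Module.End.eigenspace (φQ.baseChange ℂ) μK) =>
        UnitaryTheta.apply_mem_eigenspace_of_commute hv₀φ hx) = 1 := by
    rw [det_restrict_eq_of_apply_eq_sum bW hbW _ M (fun ℓ => by rw [LinearEquiv.coe_coe, hv₀cb, hGm0]), hdetM]
  -- §2: the transport `v` of `v₀` lies in `Hg|_{H¹}`, hence in `S(A)(h)`
  have hvHg := hW.trans_mem_hodgeGroupOne_blocked_of_det_eq_one φE hEcard μ hinj hdist hWne htop hKE hKE' ψ hSU
    hv₀φ hv₀φE hv₀ψ hv₀det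
  set v : complexBetti A.X 1 ≃ₗ[ℂ] complexBetti A.X 1 := ρ.symm.trans (v₀.trans ρ) with hvdef
  have hv_apply : ∀ z, v z = ρ (v₀ (ρ.symm z)) := fun z => rfl
  have hvS : v ∈ unitaryCentralizerGroup A h := hodgeGroupOne_le_unitaryCentralizerGroup hh hvHg
  have hvxb : ∀ t ℓ, v (xb (t, ℓ)) = ∑ r, Gm t r ℓ • xb (t, r) := fun t ℓ => by
    rw [hxb_apply, hv_apply, ρ.symm_apply_apply, hv₀cb, map_sum]
    exact Finset.sum_congr rfl fun r _ => by rw [map_smul, hxb_apply]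
  -- `u = v`: they agree on the letters of `W_K` …
  have huv0 : ∀ ℓ, u (xb (0, ℓ)) = v (xb (0, ℓ)) := fun ℓ => by rw [hMu, hvxb, hGm0]
  -- … `W̄_K` is `Q_h`-isotropic …
  have hisoQ : ∀ y ∈ Module.End.eigenspace (pullbackOne A φ) (-μK), ∀ y' ∈ Module.End.eigenspace (pullbackOne A φ) (-μK),
      Q y y' = 0 := by
    intro y hy y' hy'
    rw [Module.End.mem_eigenspace_iff] at hy hy'
    have h1 := hφQ y y'
    rw [hy, hy', map_smul, LinearMap.map_smul₂, smul_smul, neg_mul_neg, hμK2] at h1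
    have h2 : ((2 : ℂ) * (d : ℂ)) • Q y y' = 0 := by
      rw [mul_smul, two_smul]
      nth_rw 1 [← h1]
      rw [neg_smul, neg_add_cancel]
    rcases smul_eq_zero.1 h2 with h3 | h3
    · exfalso
      exact mul_ne_zero two_ne_zero (Nat.cast_ne_zero.2 hW.d_pos.ne') h3
    · exact h3
  have hxbW' : ∀ ℓ, xb (1, ℓ) ∈ Module.End.eigenspace (pullbackOne A φ) (-μK) := fun ℓ =>
    Module.End.mem_eigenspace_iff.2 (by rw [hφxb, if_neg one_ne_zero])
  have hvφ : ∀ z, v (pullbackOne A φ z) = pullbackOne A φ (v z) := fun z => (mem_centralizerGroup_iff.1 hvS.1) φ z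
  -- … so they agree on the letters of `W̄_K` (`Q_h` non-degenerate)
  have huv1 : ∀ ℓ, u (xb (1, ℓ)) = v (xb (1, ℓ)) := by
    intro ℓ
    rw [← sub_eq_zero]
    apply hnd
    suffices hcomp : Q (u (xb (1, ℓ)) - v (xb (1, ℓ))) ∘ₗ (u : complexBetti A.X 1 →ₗ[ℂ] complexBetti A.X 1) = 0 by
      intro y
      obtain ⟨z, rfl⟩ := u.surjective y
      have e := LinearMap.congr_fun hcomp z
      rwa [LinearMap.comp_apply, LinearEquiv.coe_coe, LinearMap.zero_apply] at e
    refine xb.ext fun tk => ?_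
    obtain ⟨t, k⟩ := tk
    rw [LinearMap.comp_apply, LinearEquiv.coe_coe, LinearMap.zero_apply, map_sub, LinearMap.sub_apply]
    rcases fin2_cases₆ t with rfl | rfl
    · rw [hu.2, huv0, hvS.2, sub_self]
    · have hmem : ∀ w : complexBetti A.X 1 ≃ₗ[ℂ] complexBetti A.X 1, (∀ z, w (pullbackOne A φ z) = pullbackOne A φ (w z)) →
          ∀ ℓ', w (xb (1, ℓ')) ∈ Module.End.eigenspace (pullbackOne A φ) (-μK) :=
        fun w hw ℓ' => VanGeemen1994.mapsTo_eigenspace_of_comm hw (-μK) (hxbW' ℓ')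
      rw [hisoQ _ (hmem u huφ ℓ) _ (hmem u huφ k), hisoQ _ (hmem v hvφ ℓ) _ (hmem u huφ k), sub_self]
  have huv : u = v := by
    refine LinearEquiv.ext fun z => ?_
    have e : (u : complexBetti A.X 1 →ₗ[ℂ] complexBetti A.X 1) = (v : complexBetti A.X 1 →ₗ[ℂ] complexBetti A.X 1) := by
      refine xb.ext fun tk => ?_
      obtain ⟨t, k⟩ := tk
      rcases fin2_cases₆ t with rfl | rfl
      · exact huv0 k
      · exact huv1 k
    exact LinearMap.congr_fun e z
  rw [huv]
  exact hvHg

end SocketP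

end Literature.AlgebraicGeometry.HodgeTheory

end
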